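import Summits.CriticalPhenomena.PercolationContinuityZ3.Theses.PercNearOneGluing
import Literature.Probability.Percolation.PercolationProofs
import Mathlib

/-!
# Crux `PercNearOneGluing.NoHeavyLowerTail` (stmt-CriticalPhenomena-4575), line
`bhk-superadditivity-thinning` — stub `maxPioneerCharging_of_selection` (MAXD from any disjoint
pioneer selection)

Helper file for the crux skeleton (lead prover-line-stmt-CriticalPhenomena-4575-c4-0): proves
exactly the registered stub signature `maxPioneerCharging_of_selection`; lands with
`--supports stmt-CriticalPhenomena-4575`.

## The theorem

Bond percolation with independent edges on the complete graph `Fin n`, law `μ = prodBernoulli w`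
on `BondConfig (Fin n)`.  Relay set `A`, observer `o ∉ A`, target `b ∈ A`, budgets
`r a = μ(a ↮ b)`.  The *pioneer event* of `a ∈ A` is `P a = {o ↔ a inside (↑A)ᶜ ∪ {o, a}}`, and
`a'` *loses to* `a` iff `r a' < r a ∨ (r a' = r a ∧ a' ≤ a)` (lexicographic key `(r, index)`).
The *top event* of `a` is `Top a = P a ∧ (every pioneer a' ∈ A loses to a)`.

`MAXD` (the typed hypothesis of the landed reduction
`manyFingersLargePocket_of_maxPioneerCharging`) reads
`μ(o ↔ A, o ↮ b) ≤ Σ_{a ∈ A} μ(Top a) · r a`.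

**Statement.**  If the defect `μ(o ↔ A, o ↮ b)` is charged to *any* family of pairwise disjoint
selection events `S a ⊆ P a` (`a ∈ A`) with the budgets `r a`, i.e.
`μ(o ↔ A, o ↮ b) ≤ Σ_{a ∈ A} μ(S a) · r a`, then `MAXD` holds.

## Proof

It suffices to show `Σ_a μ(S a) r a ≤ Σ_a μ(Top a) r a`; this is a deterministic comparison on the
finite set `A` (`maxPCsel_sum_le`, stated for any finite measure on a discrete space):
* on `S a` the point `a` is a pioneer, so the set of pioneers is a nonempty finite set and its
  `(r, index)`-maximum `a*` satisfies `ω ∈ Top a*` (`maxPCsel_exists_top`, `Finset.exists_max_image`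
  on the key `toLex (r a', a')`); hence `S a ⊆ ⋃_{a' ∈ A} (S a ∩ Top a')` and
  `μ(S a) ≤ Σ_{a'} μ(S a ∩ Top a')`;
* on `S a ∩ Top a'` we have `r a ≤ r a'` (`a` is a pioneer and loses to `a'`), so
  `μ(S a ∩ Top a') r a ≤ μ(S a ∩ Top a') r a'` (`maxPCsel_term_le`);
* swapping the sums, `Σ_a μ(S a ∩ Top a') = μ((⋃_a S a) ∩ Top a') ≤ μ(Top a')` because the
  `S a` are pairwise disjoint (`measureReal_biUnion_finset`, `measureReal_mono`), and `r a' ≥ 0`.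
-/

namespace Summit.CriticalPhenomena.PercolationContinuityZ3.Theorems

open scoped Classical
open MeasureTheory Set
open Literature.Probability.LatticeModels (prodBernoulli)
open Literature.Probability.Percolation (openConn openConnIn BondConfig)

section MaxPioneerChargingOfSelectionAux

/-- **A present point has a present `(r, index)`-maximum.**  On a finite index set `A` with a
score `r` (ties broken by the linear order of the index type): if `a ∈ A` is present at `ω`
(`ω ∈ P a`), then some present `a₀ ∈ A` beats-or-equals every present `a' ∈ A`, i.e.
`r a' < r a₀ ∨ (r a' = r a₀ ∧ a' ≤ a₀)` (the maximum of the key `toLex (r a', a')` over the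
nonempty finite set of present indices, `Finset.exists_max_image`). [folklore] -/
theorem maxPCsel_exists_top {Ω ι : Type*} [LinearOrder ι] (A : Finset ι) (P : ι → Set Ω)
    (r : ι → ℝ) {a : ι} (ha : a ∈ A) {ω : Ω} (hω : ω ∈ P a) :
    ∃ a₀ ∈ A, ω ∈ P a₀ ∧ ∀ a' ∈ A, ω ∈ P a' → (r a' < r a₀ ∨ (r a' = r a₀ ∧ a' ≤ a₀)) := by
  obtain ⟨a₀, ha₀, hmax⟩ := (A.filter (fun a' => ω ∈ P a')).exists_max_image
    (fun a' => toLex (r a', a')) ⟨a, Finset.mem_filter.2 ⟨ha, hω⟩⟩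
  refine ⟨a₀, (Finset.mem_filter.1 ha₀).1, (Finset.mem_filter.1 ha₀).2, fun a' ha' hP => ?_⟩
  exact (Prod.Lex.toLex_le_toLex (x := (r a', a')) (y := (r a₀, a₀))).1
    (hmax a' (Finset.mem_filter.2 ⟨ha', hP⟩))

/-- **The selected budget is at most the top budget, term by term.**  If `S ⊆ P a` and
`Top = P a₀ ∧ (∀ a' ∈ A, P a' → a' loses to a₀)` with `a ∈ A`, then
`μ(S ∩ Top) · r a ≤ μ(S ∩ Top) · r a₀`: either `S ∩ Top = ∅` (both sides vanish) or some
`ω ∈ S ∩ Top` witnesses that `a` is present and loses to `a₀`, whence `r a ≤ r a₀`. [folklore] -/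
theorem maxPCsel_term_le {Ω ι : Type*} [MeasurableSpace Ω] [LE ι] (μ : Measure Ω)
    (A : Finset ι) (P : ι → Set Ω) (S : Set Ω) (r : ι → ℝ) {a : ι} (ha : a ∈ A) (hS : S ⊆ P a)
    (a₀ : ι) :
    μ.real (S ∩ {ω | ω ∈ P a₀ ∧ ∀ a' ∈ A, ω ∈ P a' → (r a' < r a₀ ∨ (r a' = r a₀ ∧ a' ≤ a₀))}) *
        r a ≤
      μ.real (S ∩ {ω | ω ∈ P a₀ ∧ ∀ a' ∈ A, ω ∈ P a' → (r a' < r a₀ ∨ (r a' = r a₀ ∧ a' ≤ a₀))}) *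
        r a₀ := by
  rcases Set.eq_empty_or_nonempty
      (S ∩ {ω | ω ∈ P a₀ ∧ ∀ a' ∈ A, ω ∈ P a' → (r a' < r a₀ ∨ (r a' = r a₀ ∧ a' ≤ a₀))})
    with h | ⟨ω, hωS, -, hall⟩
  · rw [h, measureReal_empty, zero_mul, zero_mul]
  · refine mul_le_mul_of_nonneg_left ?_ measureReal_nonneg
    rcases hall a ha (hS hωS) with h | ⟨h, -⟩
    · exact le_of_lt h
    · exact le_of_eq h

/-- **Deterministic charging comparison (any disjoint selection ≤ max-key selection).**  Finite
measure `μ` on a discrete space, finite index set `A`, presence events `P a`, nonnegative budgets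
`r a`, and pairwise disjoint selection events `S a ⊆ P a` (`a ∈ A`).  Then
`Σ_{a ∈ A} μ(S a) · r a ≤ Σ_{a ∈ A} μ(Top a) · r a`, where
`Top a = P a ∧ (∀ a' ∈ A, P a' → (r a' < r a ∨ (r a' = r a ∧ a' ≤ a)))` is the event that `a` is
present and is the `(r, index)`-maximum of the present points.  Proof: `S a ⊆ ⋃_{a'} Top a'`
(`maxPCsel_exists_top`), `r a ≤ r a'` on `S a ∩ Top a'` (`maxPCsel_term_le`), swap the two sums
and use the disjointness of the `S a` (`measureReal_biUnion_finset`). [folklore] -/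
theorem maxPCsel_sum_le {Ω ι : Type*} [MeasurableSpace Ω] [DiscreteMeasurableSpace Ω]
    [LinearOrder ι] (μ : Measure Ω) [IsFiniteMeasure μ] (A : Finset ι) (P S : ι → Set Ω)
    (r : ι → ℝ) (hr : ∀ a ∈ A, 0 ≤ r a) (hS : ∀ a ∈ A, S a ⊆ P a)
    (hdisj : (↑A : Set ι).PairwiseDisjoint S) :
    ∑ a ∈ A, μ.real (S a) * r a ≤
      ∑ a ∈ A, μ.real {ω | ω ∈ P a ∧ ∀ a' ∈ A, ω ∈ P a' → (r a' < r a ∨ (r a' = r a ∧ a' ≤ a))} *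
        r a := by
  set T : ι → Set Ω :=
    fun a => {ω | ω ∈ P a ∧ ∀ a' ∈ A, ω ∈ P a' → (r a' < r a ∨ (r a' = r a ∧ a' ≤ a))} with hT
  -- step 1: every selected configuration lies in some top event
  have hcover : ∀ a ∈ A, S a ⊆ ⋃ a' ∈ A, (S a ∩ T a') := by
    intro a ha ω hω
    obtain ⟨a₀, ha₀, hP₀, hall⟩ := maxPCsel_exists_top A P r ha (hS a ha hω)
    exact Set.mem_iUnion₂.2 ⟨a₀, ha₀, hω, hP₀, hall⟩
  have h1 : ∀ a ∈ A, μ.real (S a) ≤ ∑ a' ∈ A, μ.real (S a ∩ T a') := fun a ha =>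
    (measureReal_mono (hcover a ha) (measure_ne_top μ _)).trans (measureReal_biUnion_finset_le A _)
  -- step 2: on `S a ∩ T a'` the budget of `a` is at most the budget of `a'`
  have h2 : ∀ a ∈ A, ∀ a' ∈ A, μ.real (S a ∩ T a') * r a ≤ μ.real (S a ∩ T a') * r a' :=
    fun a ha a' _ => maxPCsel_term_le μ A P (S a) r ha (hS a ha) a'
  -- step 3: the `S a ∩ T a'`, `a ∈ A`, are pairwise disjoint pieces of `T a'`
  have h3 : ∀ a' ∈ A, ∑ a ∈ A, μ.real (S a ∩ T a') ≤ μ.real (T a') := by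
    intro a' _
    rw [← measureReal_biUnion_finset (hdisj.mono fun a => Set.inter_subset_left)
      (fun _ _ => MeasurableSet.of_discrete)]
    exact measureReal_mono (Set.iUnion₂_subset fun a _ => Set.inter_subset_right)
  calc ∑ a ∈ A, μ.real (S a) * r a
      ≤ ∑ a ∈ A, (∑ a' ∈ A, μ.real (S a ∩ T a')) * r a :=
        Finset.sum_le_sum fun a ha => mul_le_mul_of_nonneg_right (h1 a ha) (hr a ha)
    _ = ∑ a ∈ A, ∑ a' ∈ A, μ.real (S a ∩ T a') * r a :=
        Finset.sum_congr rfl fun a _ => Finset.sum_mul _ _ _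
    _ ≤ ∑ a ∈ A, ∑ a' ∈ A, μ.real (S a ∩ T a') * r a' :=
        Finset.sum_le_sum fun a ha => Finset.sum_le_sum fun a' ha' => h2 a ha a' ha'
    _ = ∑ a' ∈ A, ∑ a ∈ A, μ.real (S a ∩ T a') * r a' := Finset.sum_comm
    _ = ∑ a' ∈ A, (∑ a ∈ A, μ.real (S a ∩ T a')) * r a' :=
        Finset.sum_congr rfl fun a' _ => (Finset.sum_mul _ _ _).symm
    _ ≤ ∑ a' ∈ A, μ.real (T a') * r a' :=
        Finset.sum_le_sum fun a' ha' => mul_le_mul_of_nonneg_right (h3 a' ha') (hr a' ha')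

end MaxPioneerChargingOfSelectionAux

/-- **MAXD from any disjoint pioneer selection** (registered stub `maxPioneerCharging_of_selection`
of crux stmt-CriticalPhenomena-4575, line bhk-superadditivity-thinning).  With
`μ = prodBernoulli w` on `BondConfig (Fin n)`, relay set `A ∋ b`, observer `o ∉ A`, budgets
`r a = μ(a ↮ b)`, pioneer events `P a = {o ↔ a inside (↑A)ᶜ ∪ {o, a}}` and "`a'` loses to `a`"
iff `r a' < r a ∨ (r a' = r a ∧ a' ≤ a)`: if the gluing defect `μ({o ↔ A} ∩ {o ↮ b})` is at most
`Σ_{a ∈ A} μ(S a) · r a` for some pairwise disjoint selection events `S a ⊆ P a`, then it is at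
most `Σ_{a ∈ A} μ(P a ∧ ∀ a' ∈ A, P a' → a' loses to a) · r a` (the typed hypothesis `MAXD` of
`manyFingersLargePocket_of_maxPioneerCharging`).  Pointwise, the selected pioneer's budget is at
most the budget of the `(r, index)`-maximal pioneer; the bookkeeping is `maxPCsel_sum_le`. -/
theorem maxPioneerCharging_of_selection : ∀ (n : ℕ) (w : Sym2 (Fin n) → unitInterval) (A : Finset (Fin n)) (o b : Fin n) (S : Fin n → Set (Literature.Probability.Percolation.BondConfig (Fin n))), b ∈ A → o ∉ A → (∀ a ∈ A, S a ⊆ Literature.Probability.Percolation.openConnIn ((↑A : Set (Fin n))ᶜ ∪ {o, a}) o a) → (↑A : Set (Fin n)).PairwiseDisjoint S → (Literature.Probability.LatticeModels.prodBernoulli w).real ((⋃ a ∈ A, Literature.Probability.Percolation.openConn o a) ∩ (Literature.Probability.Percolation.openConn o b)ᶜ) ≤ ∑ a ∈ A, (Literature.Probability.LatticeModels.prodBernoulli w).real (S a) * (Literature.Probability.LatticeModels.prodBernoulli w).real (Literature.Probability.Percolation.openConn a b)ᶜ → (Literature.Probability.LatticeModels.prodBernoulli w).real ((⋃ a ∈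 A, Literature.Probability.Percolation.openConn o a) ∩ (Literature.Probability.Percolation.openConn o b)ᶜ) ≤ ∑ a ∈ A, (Literature.Probability.LatticeModels.prodBernoulli w).real {ω : Literature.Probability.Percolation.BondConfig (Fin n) | ω ∈ Literature.Probability.Percolation.openConnIn ((↑A : Set (Fin n))ᶜ ∪ {o, a}) o a ∧ ∀ a' ∈ A, ω ∈ Literature.Probability.Percolation.openConnIn ((↑A : Set (Fin n))ᶜ ∪ {o, a'}) o a' → ((Literature.Probability.LatticeModels.prodBernoulli w).real (Literature.Probability.Percolation.openConn a' b)ᶜ < (Literature.Probability.LatticeModels.prodBernoulli w).real (Literature.Probability.Percolation.openConn a b)ᶜ ∨ ((Literature.Probability.LatticeModels.prodBernoulli w).real (Literature.Probability.Percolation.openConn a' b)ᶜ = (Literature.Probability.LatticeModels.prodBernoulli w).real (Literature.Probability.Percolation.openConn a b)ᶜ ∧ a' ≤ a))} * (Literature.Probability.LatticeModels.prodBernoulli w).real (Literature.Probability.Percolation.openConn a b)ᶜ := by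
  intro n w A o b S _ _ hS hdisj hbad
  refine hbad.trans ?_
  exact maxPCsel_sum_le (prodBernoulli w) A
    (fun a => openConnIn ((↑A : Set (Fin n))ᶜ ∪ {o, a}) o a) S
    (fun a => (prodBernoulli w).real (openConn a b)ᶜ) (fun a _ => measureReal_nonneg) hS hdisj

end Summit.CriticalPhenomena.PercolationContinuityZ3.Theorems
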